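import Summits.CriticalPhenomena.PercolationContinuityZ3.Theorems.SahiBoxTP2Split
import Literature.Probability.Percolation.QuadCrossingContinuityEventsProofs
import Mathlib.MeasureTheory.Measure.Portmanteau

/-!
# Box-TP₂ is closed under weak convergence

Support file of the Sahi cell (`prim-sahi`, typer seat, generation 14; `--supports stmt-CriticalPhenomena-4575`).
Theorems only (no definitions, no named facts, no sorries).

`IsBoxTP2 μ` (`SahiBoxTP2Split.lean`) — `μ[a,b] μ[a',b'] ≤ μ[a ⊓ a', b ⊓ b'] μ[a ⊔ a', b ⊔ b']` for all closed
order boxes — is the cell's intrinsic form of the FKG lattice condition / MTP₂ / Milgrom–Weber affiliation for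
ARBITRARY (possibly singular) measures (generations 11–13: equivalent to cell-FKG on every grid, to set-TP₂ and
to affiliation; the hypothesis under which `C_n` gives Sahi positivity of every order).  This file adds the
missing CLOSURE THEOREM of the theory:

**the class of box-TP₂ finite measures is closed under weak convergence.**

* `IsBoxTP2.of_limsup_liminf` — the abstract mechanism (no topology): if the boxes of the limit `μ` are
  approximated from outside by boxes `[loₙ a, hiₙ b]` with `loₙ, hiₙ` commuting with `⊓, ⊔`, on which
  `μ[a,b] ≤ liminfᵢ μᵢ[loₙ a, hiₙ b]`, `limsupᵢ μᵢ[loₙ a, hiₙ b] ≤ μ[loₙ a, hiₙ b]` and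
  `μ[loₙ a, hiₙ b] → μ[a,b]`, then box-TP₂ of (eventually all) `μᵢ` passes to `μ`.  Proof:
  `μ[a,b] μ[a',b'] ≤ liminf μᵢ[·] · liminf μᵢ[·] ≤ liminf (μᵢ[·] μᵢ[·]) ≤ limsup (μᵢ[meet] μᵢ[join])
   ≤ limsup μᵢ[meet] · limsup μᵢ[join] ≤ μ[meetₙ] μ[joinₙ] → μ[meet] μ[join]`
  (`ENNReal.le_liminf_mul`, `ENNReal.limsup_mul_le'`).
* `IsBoxTP2.of_portmanteau` — the same with the two portmanteau inequalities (open sets / closed sets) and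
  `[a,b] ⊆ interior [loₙ a, hiₙ b]` as input; `IsBoxTP2.of_tendsto_finiteMeasure` /
  `IsBoxTP2.of_tendsto_probabilityMeasure` — from weak convergence in Mathlib's topologies
  (`FiniteMeasure.limsup_measure_closed_le_of_tendsto`, the tree's
  `Literature.Probability.Percolation.finiteMeasure_le_liminf_measure_open_of_tendsto`).
* `IsBoxTP2.of_tendsto_finiteMeasure_pi` — finite products `Π i, α i` of linearly ordered coordinates, where
  the outer boxes are built coordinatewise from monotone maps `lₙⁱ ↑`, `uₙⁱ ↓` with
  `[s,t] ⊆ interior [lₙⁱ s, uₙⁱ t]` and `⋂ₙ [lₙⁱ s, uₙⁱ t] = [s,t]`.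
* Instances: the unit cube `Q_d = (Fin d → [0,1])` (`isBoxTP2_of_tendsto_finiteMeasure_cube`,
  `…_probabilityMeasure_cube`; outer boxes `[π(a − 1/(n+1)), π(b + 1/(n+1))]`, `π` the clamp to `[0,1]`) and
  `ℝ^d` (`isBoxTP2_of_tendsto_finiteMeasure_real`, `…_probabilityMeasure_real`; outer boxes
  `[a − 1/(n+1), b + 1/(n+1)]`).

This is the multivariate, measure-level analogue of the weak closure of the likelihood-ratio order
(Müller 1997; Müller–Stoyan, *Comparison Methods for Stochastic Models and Risks*, Thm. 1.4.9, proved by the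
same portmanteau-and-enlarged-intervals device); for MTP₂ DENSITIES closure under pointwise limits is
trivial, but a weak limit of MTP₂ densities need not have a density — box-TP₂ is the notion that survives.
Consequences (companion files): weak limits of finite-volume Ising / lattice-field Gibbs measures, of
Gaussians with `M`-matrix precisions, of discretisations, … are box-TP₂, hence FKG for all bounded measurable
monotone functionals and, given `C_n`, Sahi-positive of order `n`.

No sorries, no new axioms.
-/

noncomputable section

namespace Summit.CriticalPhenomena.PercolationContinuityZ3.Theorems.SahiBoxTP2

open MeasureTheory Set Filter Topology Function
open scoped ENNReal unitInterval

/-! ### The abstract mechanism -/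

section Abstract

variable {β ι : Type*} [Lattice β] [MeasurableSpace β]

/-- **Box-TP₂ passes to limits along outer box approximations** (no topology).  If the boxes `[a,b]` of the
finite measure `μ` are approximated by boxes `[loₙ a, hiₙ b]` with `loₙ`, `hiₙ` commuting with `⊓` and `⊔`, such
that `μ[a,b] ≤ liminfᵢ μᵢ[loₙ a, hiₙ b]`, `limsupᵢ μᵢ[loₙ a, hiₙ b] ≤ μ[loₙ a, hiₙ b]` and `μ[loₙ a, hiₙ b] → μ[a,b]`,
and the `μᵢ` are eventually box-TP₂, then `μ` is box-TP₂. [this work] -/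
theorem IsBoxTP2.of_limsup_liminf {L : Filter ι} [NeBot L] {μs : ι → Measure β} {μ : Measure β}
    [IsFiniteMeasure μ] (hbox : ∀ᶠ i in L, IsBoxTP2 (μs i)) (lo hi : ℕ → β → β)
    (hlo_inf : ∀ n a a', lo n (a ⊓ a') = lo n a ⊓ lo n a')
    (hlo_sup : ∀ n a a', lo n (a ⊔ a') = lo n a ⊔ lo n a')
    (hhi_inf : ∀ n b b', hi n (b ⊓ b') = hi n b ⊓ hi n b')
    (hhi_sup : ∀ n b b', hi n (b ⊔ b') = hi n b ⊔ hi n b')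
    (hliminf : ∀ n a b, μ (Icc a b) ≤ liminf (fun i => μs i (Icc (lo n a) (hi n b))) L)
    (hlimsup : ∀ n a b, limsup (fun i => μs i (Icc (lo n a) (hi n b))) L ≤ μ (Icc (lo n a) (hi n b)))
    (hlim : ∀ a b, Tendsto (fun n => μ (Icc (lo n a) (hi n b))) atTop (𝓝 (μ (Icc a b)))) :
    IsBoxTP2 μ := by
  intro a b a' b'
  have key : ∀ n, μ (Icc a b) * μ (Icc a' b') ≤
      μ (Icc (lo n (a ⊓ a')) (hi n (b ⊓ b'))) * μ (Icc (lo n (a ⊔ a')) (hi n (b ⊔ b'))) := by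
    intro n
    set u : ι → ℝ≥0∞ := fun i => μs i (Icc (lo n a) (hi n b)) with hu
    set v : ι → ℝ≥0∞ := fun i => μs i (Icc (lo n a') (hi n b')) with hv
    set m : ι → ℝ≥0∞ := fun i => μs i (Icc (lo n (a ⊓ a')) (hi n (b ⊓ b'))) with hm
    set j : ι → ℝ≥0∞ := fun i => μs i (Icc (lo n (a ⊔ a')) (hi n (b ⊔ b'))) with hj
    have h1 : μ (Icc a b) * μ (Icc a' b') ≤ liminf (u * v) L :=
      (mul_le_mul' (hliminf n a b) (hliminf n a' b')).trans ENNReal.le_liminf_mul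
    have h2 : liminf (u * v) L ≤ liminf (m * j) L := by
      refine liminf_le_liminf ?_
      filter_upwards [hbox] with i hbi
      have := hbi (lo n a) (hi n b) (lo n a') (hi n b')
      rw [← hlo_inf, ← hhi_inf, ← hlo_sup, ← hhi_sup] at this
      simpa only [Pi.mul_apply, hu, hv, hm, hj] using this
    have h3 : liminf (m * j) L ≤ limsup (m * j) L := liminf_le_limsup
    have hml : limsup m L ≤ μ (Icc (lo n (a ⊓ a')) (hi n (b ⊓ b'))) := hlimsup n _ _
    have hjl : limsup j L ≤ μ (Icc (lo n (a ⊔ a')) (hi n (b ⊔ b'))) := hlimsup n _ _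
    have hmfin : limsup m L ≠ ∞ := ne_top_of_le_ne_top (measure_ne_top μ _) hml
    have hjfin : limsup j L ≠ ∞ := ne_top_of_le_ne_top (measure_ne_top μ _) hjl
    have h4 : limsup (m * j) L ≤ limsup m L * limsup j L :=
      ENNReal.limsup_mul_le' (Or.inr hjfin) (Or.inl hmfin)
    exact h1.trans (h2.trans (h3.trans (h4.trans (mul_le_mul' hml hjl))))
  have hT : Tendsto (fun n => μ (Icc (lo n (a ⊓ a')) (hi n (b ⊓ b'))) *
      μ (Icc (lo n (a ⊔ a')) (hi n (b ⊔ b')))) atTop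
      (𝓝 (μ (Icc (a ⊓ a') (b ⊓ b')) * μ (Icc (a ⊔ a') (b ⊔ b')))) :=
    ENNReal.Tendsto.mul (hlim _ _) (Or.inr (measure_ne_top μ _)) (hlim _ _)
      (Or.inr (measure_ne_top μ _))
  exact ge_of_tendsto' hT key

variable [TopologicalSpace β]

/-- **Box-TP₂ passes to weak limits: portmanteau form.**  Outer boxes `[loₙ a, hiₙ b] ⊇ interior ⊇ [a,b]`
(`loₙ`, `hiₙ` commuting with `⊓`, `⊔`, `μ[loₙ a, hiₙ b] → μ[a,b]`), the portmanteau inequalities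
`μ G ≤ liminf μᵢ G` (`G` open) and `limsup μᵢ F ≤ μ F` (`F` closed), closed boxes: then box-TP₂ of (eventually
all) `μᵢ` passes to the finite measure `μ`. [this work] -/
theorem IsBoxTP2.of_portmanteau [OrderClosedTopology β] {L : Filter ι} [NeBot L] {μs : ι → Measure β}
    {μ : Measure β} [IsFiniteMeasure μ] (hbox : ∀ᶠ i in L, IsBoxTP2 (μs i)) (lo hi : ℕ → β → β)
    (hlo_inf : ∀ n a a', lo n (a ⊓ a') = lo n a ⊓ lo n a')
    (hlo_sup : ∀ n a a', lo n (a ⊔ a') = lo n a ⊔ lo n a')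
    (hhi_inf : ∀ n b b', hi n (b ⊓ b') = hi n b ⊓ hi n b')
    (hhi_sup : ∀ n b b', hi n (b ⊔ b') = hi n b ⊔ hi n b')
    (hint : ∀ n a b, Icc a b ⊆ interior (Icc (lo n a) (hi n b)))
    (hopen : ∀ G : Set β, IsOpen G → μ G ≤ liminf (fun i => μs i G) L)
    (hclosed : ∀ F : Set β, IsClosed F → limsup (fun i => μs i F) L ≤ μ F)
    (hlim : ∀ a b, Tendsto (fun n => μ (Icc (lo n a) (hi n b))) atTop (𝓝 (μ (Icc a b)))) :
    IsBoxTP2 μ := by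
  refine IsBoxTP2.of_limsup_liminf hbox lo hi hlo_inf hlo_sup hhi_inf hhi_sup (fun n a b => ?_)
    (fun n a b => hclosed _ isClosed_Icc) hlim
  calc μ (Icc a b) ≤ μ (interior (Icc (lo n a) (hi n b))) := measure_mono (hint n a b)
    _ ≤ liminf (fun i => μs i (interior (Icc (lo n a) (hi n b)))) L := hopen _ isOpen_interior
    _ ≤ liminf (fun i => μs i (Icc (lo n a) (hi n b))) L :=
        liminf_le_liminf (Eventually.of_forall fun i => measure_mono interior_subset)

variable [OpensMeasurableSpace β] [HasOuterApproxClosed β]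

/-- **Box-TP₂ is closed under weak convergence of finite measures** (Mathlib's topology on
`FiniteMeasure β`), given outer box approximations of the limit's boxes. [this work] -/
theorem IsBoxTP2.of_tendsto_finiteMeasure [OrderClosedTopology β] {L : Filter ι} [NeBot L]
    {μs : ι → FiniteMeasure β} {μ : FiniteMeasure β} (hconv : Tendsto μs L (𝓝 μ))
    (hbox : ∀ᶠ i in L, IsBoxTP2 (μs i : Measure β)) (lo hi : ℕ → β → β)
    (hlo_inf : ∀ n a a', lo n (a ⊓ a') = lo n a ⊓ lo n a')
    (hlo_sup : ∀ n a a', lo n (a ⊔ a') = lo n a ⊔ lo n a')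
    (hhi_inf : ∀ n b b', hi n (b ⊓ b') = hi n b ⊓ hi n b')
    (hhi_sup : ∀ n b b', hi n (b ⊔ b') = hi n b ⊔ hi n b')
    (hint : ∀ n a b, Icc a b ⊆ interior (Icc (lo n a) (hi n b)))
    (hlim : ∀ a b, Tendsto (fun n => (μ : Measure β) (Icc (lo n a) (hi n b))) atTop
      (𝓝 ((μ : Measure β) (Icc a b)))) :
    IsBoxTP2 (μ : Measure β) :=
  IsBoxTP2.of_portmanteau hbox lo hi hlo_inf hlo_sup hhi_inf hhi_sup hint
    (fun _ hG => Literature.Probability.Percolation.QuadCrossing.finiteMeasure_le_liminf_measure_open_of_tendsto hconv hG)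
    (fun _ hF => FiniteMeasure.limsup_measure_closed_le_of_tendsto hconv hF) hlim

/-- **Box-TP₂ is closed under weak convergence of probability measures** (Mathlib's topology on
`ProbabilityMeasure β`), given outer box approximations of the limit's boxes. [this work] -/
theorem IsBoxTP2.of_tendsto_probabilityMeasure [OrderClosedTopology β] {L : Filter ι} [NeBot L]
    {μs : ι → ProbabilityMeasure β} {μ : ProbabilityMeasure β} (hconv : Tendsto μs L (𝓝 μ))
    (hbox : ∀ᶠ i in L, IsBoxTP2 (μs i : Measure β)) (lo hi : ℕ → β → β)
    (hlo_inf : ∀ n a a', lo n (a ⊓ a') = lo n a ⊓ lo n a')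
    (hlo_sup : ∀ n a a', lo n (a ⊔ a') = lo n a ⊔ lo n a')
    (hhi_inf : ∀ n b b', hi n (b ⊓ b') = hi n b ⊓ hi n b')
    (hhi_sup : ∀ n b b', hi n (b ⊔ b') = hi n b ⊔ hi n b')
    (hint : ∀ n a b, Icc a b ⊆ interior (Icc (lo n a) (hi n b)))
    (hlim : ∀ a b, Tendsto (fun n => (μ : Measure β) (Icc (lo n a) (hi n b))) atTop
      (𝓝 ((μ : Measure β) (Icc a b)))) :
    IsBoxTP2 (μ : Measure β) :=
  IsBoxTP2.of_tendsto_finiteMeasure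
    ((ProbabilityMeasure.tendsto_nhds_iff_toFiniteMeasure_tendsto_nhds L).mp hconv)
    (hbox.mono fun i h => by
      simpa only [Function.comp_apply, ProbabilityMeasure.toMeasure_comp_toFiniteMeasure_eq_toMeasure]
        using h)
    lo hi hlo_inf hlo_sup hhi_inf hhi_sup hint
    (fun a b => by
      simpa only [Function.comp_apply, ProbabilityMeasure.toMeasure_comp_toFiniteMeasure_eq_toMeasure]
        using hlim a b)

end Abstract

/-! ### Finite products of linearly ordered coordinates -/

section Pi

/-- Coordinatewise monotone maps of a product of chains commute with `⊓`. [folklore] -/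
theorem pi_map_inf_of_monotone {κ : Type*} {α : κ → Type*} [∀ i, LinearOrder (α i)]
    (l : ∀ i, α i → α i) (hl : ∀ i, Monotone (l i)) (a a' : ∀ i, α i) :
    (fun i => l i ((a ⊓ a') i)) = (fun i => l i (a i)) ⊓ fun i => l i (a' i) := by
  funext i
  simp only [Pi.inf_apply]
  exact (hl i).map_min

/-- Coordinatewise monotone maps of a product of chains commute with `⊔`. [folklore] -/
theorem pi_map_sup_of_monotone {κ : Type*} {α : κ → Type*} [∀ i, LinearOrder (α i)]
    (l : ∀ i, α i → α i) (hl : ∀ i, Monotone (l i)) (a a' : ∀ i, α i) :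
    (fun i => l i ((a ⊔ a') i)) = (fun i => l i (a i)) ⊔ fun i => l i (a' i) := by
  funext i
  simp only [Pi.sup_apply]
  exact (hl i).map_max

variable {κ : Type*} [Fintype κ] {α : κ → Type*} [∀ i, LinearOrder (α i)] [∀ i, TopologicalSpace (α i)]
  [∀ i, OrderClosedTopology (α i)] [∀ i, MeasurableSpace (α i)]
  [OpensMeasurableSpace (∀ i, α i)] [HasOuterApproxClosed (∀ i, α i)]

/-- **Box-TP₂ is closed under weak convergence of finite measures on a finite product of chains**, given,
in each coordinate, monotone outer approximations `lₙ s ↑`, `uₙ t ↓` of the intervals with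
`[s,t] ⊆ interior [lₙ s, uₙ t]` and `⋂ₙ [lₙ s, uₙ t] ⊆ [s,t]`. [this work] -/
theorem IsBoxTP2.of_tendsto_finiteMeasure_pi {ι : Type*} {L : Filter ι} [NeBot L]
    {μs : ι → FiniteMeasure (∀ i, α i)} {μ : FiniteMeasure (∀ i, α i)} (hconv : Tendsto μs L (𝓝 μ))
    (hbox : ∀ᶠ k in L, IsBoxTP2 (μs k : Measure (∀ i, α i))) (l u : ℕ → ∀ i, α i → α i)
    (hl : ∀ n i, Monotone (l n i)) (hu : ∀ n i, Monotone (u n i))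
    (hint : ∀ n i (s t : α i), Icc s t ⊆ interior (Icc (l n i s) (u n i t)))
    (hl_mono : ∀ i (s : α i), Monotone fun n => l n i s) (hu_anti : ∀ i (t : α i), Antitone fun n => u n i t)
    (hInter : ∀ i (s t x : α i), (∀ n, l n i s ≤ x ∧ x ≤ u n i t) → s ≤ x ∧ x ≤ t) :
    IsBoxTP2 (μ : Measure (∀ i, α i)) := by
  -- one-dimensional consequences of `hint`
  have hl_le : ∀ n i (s : α i), l n i s ≤ s := fun n i s =>
    ((interior_subset (hint n i s s (left_mem_Icc.2 le_rfl))).1)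
  have hu_ge : ∀ n i (t : α i), t ≤ u n i t := fun n i t =>
    ((interior_subset (hint n i t t (left_mem_Icc.2 le_rfl))).2)
  refine IsBoxTP2.of_tendsto_finiteMeasure hconv hbox (fun n a i => l n i (a i)) (fun n b i => u n i (b i))
    (fun n a a' => pi_map_inf_of_monotone (l n) (hl n) a a')
    (fun n a a' => pi_map_sup_of_monotone (l n) (hl n) a a')
    (fun n b b' => pi_map_inf_of_monotone (u n) (hu n) b b')
    (fun n b b' => pi_map_sup_of_monotone (u n) (hu n) b b') (fun n a b => ?_) (fun a b => ?_)
  · -- `[a,b] ⊆ interior [l a, u b]`: interior of a finite product box is the product of the interiors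
    rw [← Set.pi_univ_Icc, ← Set.pi_univ_Icc, interior_pi_set finite_univ]
    exact Set.pi_mono fun i _ => hint n i (a i) (b i)
  · -- continuity from above along the decreasing outer boxes
    have hanti : Antitone fun n => Icc (fun i => l n i (a i)) (fun i => u n i (b i)) :=
      fun n m hnm => Icc_subset_Icc (fun i => hl_mono i (a i) hnm) (fun i => hu_anti i (b i) hnm)
    have hInt : (⋂ n, Icc (fun i => l n i (a i)) (fun i => u n i (b i))) = Icc a b := by
      apply Subset.antisymm
      · intro x hx
        rw [mem_iInter] at hx
        exact ⟨fun i => (hInter i (a i) (b i) (x i) fun n => ⟨(hx n).1 i, (hx n).2 i⟩).1,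
          fun i => (hInter i (a i) (b i) (x i) fun n => ⟨(hx n).1 i, (hx n).2 i⟩).2⟩
      · exact subset_iInter fun n => Icc_subset_Icc (fun i => hl_le n i (a i)) (fun i => hu_ge n i (b i))
    have := tendsto_measure_iInter_atTop (μ := (μ : Measure (∀ i, α i)))
      (fun n => (isClosed_Icc (a := fun i => l n i (a i)) (b := fun i => u n i (b i))).measurableSet
        |>.nullMeasurableSet) hanti ⟨0, measure_ne_top _ _⟩
    rw [hInt] at this
    exact this

/-- Probability-measure form of `IsBoxTP2.of_tendsto_finiteMeasure_pi`. [this work] -/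
theorem IsBoxTP2.of_tendsto_probabilityMeasure_pi {ι : Type*} {L : Filter ι} [NeBot L]
    {μs : ι → ProbabilityMeasure (∀ i, α i)} {μ : ProbabilityMeasure (∀ i, α i)}
    (hconv : Tendsto μs L (𝓝 μ)) (hbox : ∀ᶠ k in L, IsBoxTP2 (μs k : Measure (∀ i, α i)))
    (l u : ℕ → ∀ i, α i → α i) (hl : ∀ n i, Monotone (l n i)) (hu : ∀ n i, Monotone (u n i))
    (hint : ∀ n i (s t : α i), Icc s t ⊆ interior (Icc (l n i s) (u n i t)))
    (hl_mono : ∀ i (s : α i), Monotone fun n => l n i s) (hu_anti : ∀ i (t : α i), Antitone fun n => u n i t)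
    (hInter : ∀ i (s t x : α i), (∀ n, l n i s ≤ x ∧ x ≤ u n i t) → s ≤ x ∧ x ≤ t) :
    IsBoxTP2 (μ : Measure (∀ i, α i)) :=
  IsBoxTP2.of_tendsto_finiteMeasure_pi
    ((ProbabilityMeasure.tendsto_nhds_iff_toFiniteMeasure_tendsto_nhds L).mp hconv)
    (hbox.mono fun i h => by
      simpa only [Function.comp_apply, ProbabilityMeasure.toMeasure_comp_toFiniteMeasure_eq_toMeasure]
        using h)
    l u hl hu hint hl_mono hu_anti hInter

end Pi

/-! ### One-dimensional outer approximations: `ℝ` and `[0,1]` -/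

section OneDim

/-- The shrinking margin `1/(n+1) → 0`. [folklore] -/
theorem tendsto_margin : Tendsto (fun n : ℕ => (1 : ℝ) / ((n : ℝ) + 1)) atTop (𝓝 0) :=
  tendsto_one_div_add_atTop_nhds_zero_nat

/-- The margin `1/(n+1)` decreases in `n`. [folklore] -/
theorem margin_antitone : Antitone fun n : ℕ => (1 : ℝ) / ((n : ℝ) + 1) := fun n m hnm =>
  one_div_le_one_div_of_le (by positivity) (by exact_mod_cast Nat.add_le_add_right hnm 1)

/-- `ℝ`: `[s,t] ⊆ interior [s − h, t + h]` for `h > 0`. [folklore] -/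
theorem Icc_subset_interior_Icc_real {h : ℝ} (hh : 0 < h) (s t : ℝ) :
    Icc s t ⊆ interior (Icc (s - h) (t + h)) := fun x hx =>
  interior_mono Ioo_subset_Icc_self
    (by rw [interior_Ioo]; exact ⟨by linarith [hx.1], by linarith [hx.2]⟩)

/-- `ℝ`: a point lying in all `[s − 1/(n+1), t + 1/(n+1)]` lies in `[s,t]`. [folklore] -/
theorem le_of_forall_margin_real (s t x : ℝ)
    (hx : ∀ n : ℕ, s - 1 / ((n : ℝ) + 1) ≤ x ∧ x ≤ t + 1 / ((n : ℝ) + 1)) : s ≤ x ∧ x ≤ t := by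
  constructor
  · have h1 : Tendsto (fun n : ℕ => s - 1 / ((n : ℝ) + 1)) atTop (𝓝 s) := by
      simpa only [sub_zero] using tendsto_const_nhds.sub tendsto_margin
    exact le_of_tendsto' h1 fun n => (hx n).1
  · have h2 : Tendsto (fun n : ℕ => t + 1 / ((n : ℝ) + 1)) atTop (𝓝 t) := by
      simpa only [add_zero] using tendsto_const_nhds.add tendsto_margin
    exact ge_of_tendsto' h2 fun n => (hx n).2

/-- `[0,1]`: the clamped shift `v ↦ π(v + c)` is monotone. [folklore] -/
theorem monotone_projIcc_add (c : ℝ) : Monotone fun v : I => projIcc (0 : ℝ) 1 zero_le_one ((v : ℝ) + c) :=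
  fun _ _ hvw => monotone_projIcc _ (by simpa using hvw)

/-- `[0,1]`: the clamped shift `v ↦ π(v − c)` is monotone. [folklore] -/
theorem monotone_projIcc_sub (c : ℝ) : Monotone fun v : I => projIcc (0 : ℝ) 1 zero_le_one ((v : ℝ) - c) :=
  fun _ _ hvw => monotone_projIcc _ (by simpa using hvw)

/-- `[0,1]`: `[s,t] ⊆ interior [π(s − h), π(t + h)]` for `h > 0` (`π` the clamp to `[0,1]`). [folklore] -/
theorem Icc_subset_interior_Icc_unitInterval {h : ℝ} (hh : 0 < h) (s t : I) :
    Icc s t ⊆ interior (Icc (projIcc (0 : ℝ) 1 zero_le_one ((s : ℝ) - h))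
      (projIcc (0 : ℝ) 1 zero_le_one ((t : ℝ) + h))) := by
  intro x hx
  -- the relatively open interval `(s − h, t + h) ∩ [0,1]` is a neighbourhood of `x` inside the box
  have hU : IsOpen (((↑) : I → ℝ) ⁻¹' Ioo ((s : ℝ) - h) ((t : ℝ) + h)) :=
    isOpen_Ioo.preimage continuous_subtype_val
  have hxU : x ∈ ((↑) : I → ℝ) ⁻¹' Ioo ((s : ℝ) - h) ((t : ℝ) + h) := by
    have h1 : (s : ℝ) ≤ x := Subtype.coe_le_coe.mpr hx.1
    have h2 : (x : ℝ) ≤ t := Subtype.coe_le_coe.mpr hx.2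
    exact ⟨by linarith, by linarith⟩
  have hUsub : ((↑) : I → ℝ) ⁻¹' Ioo ((s : ℝ) - h) ((t : ℝ) + h) ⊆
      Icc (projIcc (0 : ℝ) 1 zero_le_one ((s : ℝ) - h)) (projIcc (0 : ℝ) 1 zero_le_one ((t : ℝ) + h)) :=
    fun y hy => ⟨(monotone_projIcc zero_le_one hy.1.le).trans_eq (projIcc_val zero_le_one y),
      (projIcc_val zero_le_one y).symm.trans_le (monotone_projIcc zero_le_one hy.2.le)⟩
  exact interior_mono hUsub (by rw [hU.interior_eq]; exact hxU)

/-- `[0,1]`: a point lying in all `[π(s − 1/(n+1)), π(t + 1/(n+1))]` lies in `[s,t]`. [folklore] -/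
theorem le_of_forall_margin_unitInterval (s t x : I)
    (hx : ∀ n : ℕ, projIcc (0 : ℝ) 1 zero_le_one ((s : ℝ) - 1 / ((n : ℝ) + 1)) ≤ x ∧
      x ≤ projIcc (0 : ℝ) 1 zero_le_one ((t : ℝ) + 1 / ((n : ℝ) + 1))) : s ≤ x ∧ x ≤ t := by
  have hx' : ∀ n : ℕ, (s : ℝ) - 1 / ((n : ℝ) + 1) ≤ x ∧ (x : ℝ) ≤ t + 1 / ((n : ℝ) + 1) := by
    intro n
    obtain ⟨h1, h2⟩ := hx n
    have h1' := Subtype.coe_le_coe.mpr h1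
    have h2' := Subtype.coe_le_coe.mpr h2
    rw [coe_projIcc] at h1' h2'
    have hm : (0 : ℝ) < 1 / ((n : ℝ) + 1) := by positivity
    have hs1 : (s : ℝ) ≤ 1 := s.2.2
    have ht0 : (0 : ℝ) ≤ t := t.2.1
    exact ⟨(le_max_of_le_right (le_min (by linarith) le_rfl)).trans h1',
      h2'.trans (max_le (by linarith) (min_le_right _ _))⟩
  have := le_of_forall_margin_real s t x hx'
  exact ⟨Subtype.coe_le_coe.mp this.1, Subtype.coe_le_coe.mp this.2⟩

end OneDim

/-! ### The unit cube `Q_d` and `ℝ^d` -/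

section Instances

variable {d : ℕ} {ι : Type*} {L : Filter ι} [NeBot L]

/-- **Box-TP₂ is closed under weak convergence of finite measures on the unit cube `Q_d = [0,1]^d`.**
[this work] -/
theorem isBoxTP2_of_tendsto_finiteMeasure_cube {μs : ι → FiniteMeasure (Fin d → I)}
    {μ : FiniteMeasure (Fin d → I)} (hconv : Tendsto μs L (𝓝 μ))
    (hbox : ∀ᶠ k in L, IsBoxTP2 (μs k : Measure (Fin d → I))) : IsBoxTP2 (μ : Measure (Fin d → I)) :=
  IsBoxTP2.of_tendsto_finiteMeasure_pi hconv hbox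
    (fun n _ s => projIcc (0 : ℝ) 1 zero_le_one ((s : ℝ) - 1 / ((n : ℝ) + 1)))
    (fun n _ t => projIcc (0 : ℝ) 1 zero_le_one ((t : ℝ) + 1 / ((n : ℝ) + 1)))
    (fun _ _ => monotone_projIcc_sub _) (fun _ _ => monotone_projIcc_add _)
    (fun n _ s t => Icc_subset_interior_Icc_unitInterval (by positivity) s t)
    (fun _ s n m hnm => monotone_projIcc _ (by linarith [margin_antitone hnm]))
    (fun _ t n m hnm => monotone_projIcc _ (by linarith [margin_antitone hnm]))
    (fun _ s t x hx => le_of_forall_margin_unitInterval s t x hx)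

/-- **Box-TP₂ is closed under weak convergence of probability measures on the unit cube `Q_d`.**
[this work] -/
theorem isBoxTP2_of_tendsto_probabilityMeasure_cube {μs : ι → ProbabilityMeasure (Fin d → I)}
    {μ : ProbabilityMeasure (Fin d → I)} (hconv : Tendsto μs L (𝓝 μ))
    (hbox : ∀ᶠ k in L, IsBoxTP2 (μs k : Measure (Fin d → I))) : IsBoxTP2 (μ : Measure (Fin d → I)) :=
  isBoxTP2_of_tendsto_finiteMeasure_cube
    ((ProbabilityMeasure.tendsto_nhds_iff_toFiniteMeasure_tendsto_nhds L).mp hconv)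
    (hbox.mono fun i h => by
      simpa only [Function.comp_apply, ProbabilityMeasure.toMeasure_comp_toFiniteMeasure_eq_toMeasure]
        using h)

/-- **Box-TP₂ is closed under weak convergence of finite measures on `ℝ^d`.** [this work] -/
theorem isBoxTP2_of_tendsto_finiteMeasure_real {μs : ι → FiniteMeasure (Fin d → ℝ)}
    {μ : FiniteMeasure (Fin d → ℝ)} (hconv : Tendsto μs L (𝓝 μ))
    (hbox : ∀ᶠ k in L, IsBoxTP2 (μs k : Measure (Fin d → ℝ))) : IsBoxTP2 (μ : Measure (Fin d → ℝ)) :=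
  IsBoxTP2.of_tendsto_finiteMeasure_pi hconv hbox
    (fun n _ s => s - 1 / ((n : ℝ) + 1)) (fun n _ t => t + 1 / ((n : ℝ) + 1))
    (fun n _ _ _ h => by linarith) (fun n _ _ _ h => by linarith)
    (fun n _ s t => Icc_subset_interior_Icc_real (by positivity) s t)
    (fun _ s n m hnm => by simp only; linarith [margin_antitone hnm])
    (fun _ t n m hnm => by simp only; linarith [margin_antitone hnm])
    (fun _ s t x hx => le_of_forall_margin_real s t x hx)

/-- **Box-TP₂ is closed under weak convergence of probability measures on `ℝ^d`.** [this work] -/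
theorem isBoxTP2_of_tendsto_probabilityMeasure_real {μs : ι → ProbabilityMeasure (Fin d → ℝ)}
    {μ : ProbabilityMeasure (Fin d → ℝ)} (hconv : Tendsto μs L (𝓝 μ))
    (hbox : ∀ᶠ k in L, IsBoxTP2 (μs k : Measure (Fin d → ℝ))) : IsBoxTP2 (μ : Measure (Fin d → ℝ)) :=
  isBoxTP2_of_tendsto_finiteMeasure_real
    ((ProbabilityMeasure.tendsto_nhds_iff_toFiniteMeasure_tendsto_nhds L).mp hconv)
    (hbox.mono fun i h => by
      simpa only [Function.comp_apply, ProbabilityMeasure.toMeasure_comp_toFiniteMeasure_eq_toMeasure]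
        using h)

end Instances

end Summit.CriticalPhenomena.PercolationContinuityZ3.Theorems.SahiBoxTP2
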